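import Literature.AlgebraicGeometry.HodgeTheory.HomComplexKInjective
import Literature.AlgebraicGeometry.HodgeTheory.HomComplexUnit
import Literature.AlgebraicGeometry.Modules.ExtCohomologyComparison
import Mathlib.Algebra.Homology.HomotopyCategory.HomComplexSingle
import HarnessLib

/-!
# The cochains of two complexes of `𝒪_X`-modules are the cochains of `𝒪_X[0]` into their internal Hom complex

Layer `Literature/AlgebraicGeometry/HodgeTheory`; sequel to `HomComplex.lean` (the internal Hom complex `𝓗om•(E•, I•)`, summands `ι`,
differentials `ι_D₁`/`ι_D₂` with Mathlib's Hom-complex sign), `HomComplexUnit.lean` (the section morphisms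
`unitToSheafHom ψ : 𝒪_X ⟶ 𝓗om(E, M)` and their composition laws) and `HomComplexKInjective.lean` (the window product
`XIsoPi : 𝓗om•(E•, I•)^n ≅ ∏_{-b ≤ i ≤ -a} 𝓗om(E^{-i}, I^{n-i})` for `E• ∈ [a, b]`). For cochain complexes `E• ∈ [a, b]` (strictly) and `I•`
of `𝒪_X`-modules on a scheme `X`, Mathlib's complex of abelian groups `CochainComplex.HomComplex E I` (degree `n`: families
`γ_p : E^p ⟶ I^{p+n}`, differential `δ γ = γ ≫ d_I + (-1)^{n+1} d_E ≫ γ`, `Cochain.δ_v`) is compared with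
`CochainComplex.HomComplex 𝒪_X[0] 𝓗om•(E•, I•)` (degree `n`: morphisms `𝒪_X ⟶ 𝓗om•(E•, I•)^n`, `Cochain.fromSingleMk`):

* `unitToSheafHom_add`, `bijective_unitToSheafHom` — `ψ ↦ (a ↦ a·ψ) : Hom(E, M) → Hom(𝒪_X, 𝓗om(E, M))` is additive and bijective
  (`app_top_one_injective/surjective`, `overFunctor_top_map_bijective`);
* `HomComplex.cochainSection n γ : 𝒪_X ⟶ 𝓗om•(E•, I•)^n` — `Σ_{i ∈ [-b,-a]} (section of γ_{-i}) ≫ ι_{(n-i, i)}`; additive;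
* **`HomComplex.cochainSection_δ`** — `cochainSection (δ γ) = cochainSection γ ≫ d_{𝓗om•}` (the two Hom-complex sign conventions AGREE:
  Mathlib's `m.negOnePow` in `δ_v` is the tree's `(n+1).negOnePow` in `ι_D₂`; the `E`-terms re-index by one with vanishing boundary
  terms, as in `HomComplexUnit.unitDeg₀_d`);
* **`HomComplex.cochainsHom E I a b : HomComplex E I ⟶ HomComplex 𝒪_X[0] 𝓗om•(E•, I•)`** — the morphism of cochain complexes of abelian
  groups `γ ↦ fromSingleMk (cochainSection γ)` (chain map by `cochainSection_δ` and `δ_fromSingleMk`);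
* `HomComplex.cochainSection_injective/surjective/bijective` — componentwise on the window product `XIsoPi`, each coordinate being the
  section of a unique morphism (`bijective_unitToSheafHom`), with the re-indexing `E^{-(-p)} ≅ E^p` (`XIsoOfEq`);
* **`HomComplex.cochainsIso E I a b : HomComplex E I ≅ HomComplex 𝒪_X[0] 𝓗om•(E•, I•)`** — `cochainsHom` is an ISOMORPHISM of cochain
  complexes of abelian groups (`isIso_cochainsHom`, degreewise `Cochain.fromSingleEquiv ∘ cochainSection`).

Everything is proved; 0 named facts. What is NOT here: the passage to `Hom_K`/`Hom_D` (Mathlib `HomComplex.CohomologyClass.homAddEquiv`,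
`homologyAddEquiv`, K-injectivity of `𝓗om•(E•, I•)` for `I•` injective) — the derived unit adjunction `Hom_D(E•, F•[k]) ≃ Hom_D(𝒪_X, 𝓗om•(E•, F•)[k])`
is the sequel `HomComplexShiftedHomUnit.lean`. Library only: nothing about any Hodge-programme crux is asserted here.

## References

* C. A. Weibel, *An introduction to homological algebra* (1994), 2.7.4–2.7.5 (the Hom cochain complex and its sign). [Weibel1994]
* The Stacks project, *More on Algebra*, Section «Hom complexes». [StacksProject]
* R. Hartshorne, *Algebraic Geometry* (1977), II §5 (sheaf Hom), III.6. [Hartshorne1977]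
-/

noncomputable section

open CategoryTheory CategoryTheory.Limits AlgebraicGeometry Opposite CochainComplex.HomComplex

universe u

namespace Literature.AlgebraicGeometry.HodgeTheory

open Literature.AlgebraicGeometry.Modules Literature.AlgebraicGeometry.Motives

/-! ## §1 The section morphisms `Hom(E, M) → Hom(𝒪_X, 𝓗om(E, M))`: additive and bijective -/

section Sections

variable {X : Scheme.{u}} {E M : X.Modules}

/-- `section (f + g) = section f + section g`. [cite: Hartshorne1977, II §5 (sheaf Hom, p. 109)] -/
lemma unitToSheafHom_add (f g : E ⟶ M) : unitToSheafHom (f + g) = unitToSheafHom f + unitToSheafHom g := by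
  rw [← sheafHomUnit_comp_sheafHomMap, ← sheafHomUnit_comp_sheafHomMap, ← sheafHomUnit_comp_sheafHomMap, sheafHomMap_add,
    Preadditive.comp_add]

/-- `section (u • f) = u • section f` for a unit sign `u`. [cite: Hartshorne1977, II §5 (sheaf Hom, p. 109)] -/
lemma unitToSheafHom_units_smul (u : ℤˣ) (f : E ⟶ M) : unitToSheafHom (u • f) = u • unitToSheafHom f := by
  rw [← sheafHomUnit_comp_sheafHomMap, ← sheafHomUnit_comp_sheafHomMap, Units.smul_def, Units.smul_def,
    show sheafHomMap E ((u : ℤ) • f) = (u : ℤ) • sheafHomMap E f from (sheafHomFunctor E).map_zsmul, Preadditive.comp_zsmul]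

/-- Evaluating the section morphism at `1 ∈ Γ(X, 𝒪_X)` returns `f` restricted to `X`. [cite: Hartshorne1977, II §5 (sheaf Hom, p. 109)] -/
lemma unitToSheafHom_app_top_one (f : E ⟶ M) :
    (unitToSheafHom f).app ⊤ (1 : X.presheaf.obj (op ⊤)) = ((SheafOfModules.overFunctor _ ⊤).map f : E.over ⊤ ⟶ M.over ⊤) := by
  rw [unitToSheafHom_app_apply, one_smul]

variable (E M) in
/-- **`Hom(E, M) → Hom(𝒪_X, 𝓗om(E, M))`, `f ↦ (a ↦ a · f)`, is a bijection** (both sides are `Γ(X, 𝓗om(E, M)) = Hom(E|_X, M|_X)`: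
`app_top_one_injective/surjective` and `overFunctor_top_map_bijective`). [cite: Hartshorne1977, II §5 (sheaf Hom, p. 109) and III Prop. 6.3 (c)] -/
theorem bijective_unitToSheafHom : Function.Bijective (unitToSheafHom : (E ⟶ M) → (unitModule X ⟶ sheafHom E M)) := by
  have hev : Function.Bijective (fun g : unitModule X ⟶ sheafHom E M => g.app ⊤ (1 : X.presheaf.obj (op ⊤))) :=
    ⟨app_top_one_injective (sheafHom E M), app_top_one_surjective (sheafHom E M)⟩
  have h : (fun g : unitModule X ⟶ sheafHom E M => g.app ⊤ (1 : X.presheaf.obj (op ⊤))) ∘ unitToSheafHom =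
      fun f : E ⟶ M => ((SheafOfModules.overFunctor X.ringCatSheaf ⊤).map f : Γ(sheafHom E M, ⊤)) :=
    funext fun f => unitToSheafHom_app_top_one f
  have hb : Function.Bijective ((fun g : unitModule X ⟶ sheafHom E M => g.app ⊤ (1 : X.presheaf.obj (op ⊤))) ∘ unitToSheafHom) := by
    rw [h]
    exact overFunctor_top_map_bijective
  exact (Function.Bijective.of_comp_iff' hev _).mp hb

/-- `section f = 0 ↔ f = 0`. [cite: Hartshorne1977, II §5 (sheaf Hom, p. 109)] -/
lemma unitToSheafHom_eq_zero_iff (f : E ⟶ M) : unitToSheafHom f = 0 ↔ f = 0 := by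
  refine ⟨fun h => (bijective_unitToSheafHom E M).1 (h.trans unitToSheafHom_zero.symm), fun h => ?_⟩
  rw [h, unitToSheafHom_zero]

end Sections

/-! ## §2 The degree-`n` section of a cochain and its differential -/

namespace HomComplex

variable (X : Scheme.{u}) (E I : CochainComplex X.Modules ℤ) (a b : ℤ)

/-- The packaged term `(section of ψ : E^{-i} → I^q) ≫ ι_{(q, i)} : 𝒪_X ⟶ 𝓗om•(E•, I•)^n` (to transport along index equalities).
[cite: Weibel1994, 2.7.4–2.7.5 (Hom cochain complex)] -/
def secTerm (n i q : ℤ) (h : q + i = n) (ψ : E.X (-i) ⟶ I.X q) : unitModule X ⟶ (homComplex X E I).X n :=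
  unitToSheafHom ψ ≫ ι X E I q i n h

/-- `secTerm` is additive in `ψ`. [cite: Weibel1994, 2.7.4–2.7.5 (Hom cochain complex)] -/
lemma secTerm_add (n i q : ℤ) (h : q + i = n) (ψ ψ' : E.X (-i) ⟶ I.X q) :
    secTerm X E I n i q h (ψ + ψ') = secTerm X E I n i q h ψ + secTerm X E I n i q h ψ' := by
  rw [secTerm, secTerm, secTerm, unitToSheafHom_add, Preadditive.add_comp]

/-- `secTerm` commutes with unit signs. [cite: Weibel1994, 2.7.4–2.7.5 (Hom cochain complex)] -/
lemma secTerm_units_smul (n i q : ℤ) (h : q + i = n) (u : ℤˣ) (ψ : E.X (-i) ⟶ I.X q) :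
    secTerm X E I n i q h (u • ψ) = u • secTerm X E I n i q h ψ := by
  rw [secTerm, secTerm, unitToSheafHom_units_smul, Linear.units_smul_comp]

/-- `secTerm` of `0` is `0`. [cite: Weibel1994, 2.7.4–2.7.5 (Hom cochain complex)] -/
lemma secTerm_zero (n i q : ℤ) (h : q + i = n) : secTerm X E I n i q h (0 : E.X (-i) ⟶ I.X q) = 0 := by
  rw [secTerm, unitToSheafHom_zero, zero_comp]

/-- Transport of a post-composed `secTerm` along an equality of the target degree. [cite: Weibel1994, 2.7.4–2.7.5 (Hom cochain complex)] -/
lemma secTerm_comp_d_congr (m i r q q' : ℤ) (e : q = q') (h : q + i = m) (h' : q' + i = m) (ψ : E.X (-i) ⟶ I.X r) :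
    secTerm X E I m i q h (ψ ≫ I.d r q) = secTerm X E I m i q' h' (ψ ≫ I.d r q') := by
  subst e; rfl

/-- Transport of a pre-composed cochain `secTerm` along equalities of the middle and target degrees. [cite: Weibel1994, 2.7.4–2.7.5 (Hom cochain complex)] -/
lemma secTerm_d_comp_v_congr {n : ℤ} (γ : Cochain E I n) (m j : ℤ) {p p' q q' : ℤ} (ep : p = p') (eq : q = q')
    (h : q + j = m) (h' : q' + j = m) (hp : p + n = q) (hp' : p' + n = q') :
    secTerm X E I m j q h (E.d (-j) p ≫ γ.v p q hp) = secTerm X E I m j q' h' (E.d (-j) p' ≫ γ.v p' q' hp') := by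
  subst ep eq; rfl

/-- **The degree-`n` section of a cochain**: `γ = (γ_p : E^p → I^{p+n})_p ↦ Σ_{i ∈ [-b, -a]} (section of γ_{-i}) ≫ ι_{(n-i, i)} :
𝒪_X ⟶ 𝓗om•(E•, I•)^n` (the window `[-b, -a]` contains every non-zero summand when `E• ∈ [a, b]`). [cite: Weibel1994, 2.7.4–2.7.5 (Hom cochain complex)] -/
def cochainSection (n : ℤ) (γ : Cochain E I n) : unitModule X ⟶ (homComplex X E I).X n :=
  ∑ i ∈ Finset.Icc (-b) (-a), secTerm X E I n i (n - i) (by lia) (γ.v (-i) (n - i) (by lia))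

/-- `cochainSection` is additive. [cite: Weibel1994, 2.7.4–2.7.5 (Hom cochain complex)] -/
lemma cochainSection_add (n : ℤ) (γ γ' : Cochain E I n) :
    cochainSection X E I a b n (γ + γ') = cochainSection X E I a b n γ + cochainSection X E I a b n γ' := by
  rw [cochainSection, cochainSection, cochainSection, ← Finset.sum_add_distrib]
  exact Finset.sum_congr rfl fun i _ => by rw [Cochain.add_v, secTerm_add]

/-- `cochainSection 0 = 0`. [cite: Weibel1994, 2.7.4–2.7.5 (Hom cochain complex)] -/
lemma cochainSection_zero (n : ℤ) : cochainSection X E I a b n (0 : Cochain E I n) = 0 :=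
  Finset.sum_eq_zero fun i _ => by rw [Cochain.zero_v, secTerm_zero]

/-- The `I`-direction on a section term: `(section γ_{-i}) ≫ ι ≫ D₁ = section (γ_{-i} ≫ d_I) ≫ ι`. [cite: Weibel1994, 2.7.4–2.7.5 (Hom cochain complex)] -/
lemma secTerm_D₁ (n i : ℤ) (ψ : E.X (-i) ⟶ I.X (n - i)) :
    secTerm X E I n i (n - i) (by lia) ψ ≫
        HomologicalComplex.mapBifunctor.D₁ I (dualComplex X E) (sheafHomBifunctor X).flip (ComplexShape.up ℤ) n (n + 1) =
      secTerm X E I (n + 1) i (n - i + 1) (by lia) (ψ ≫ I.d (n - i) (n - i + 1)) := by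
  rw [secTerm, Category.assoc, ι_D₁ X E I (n - i) i n (n + 1) (by lia) (by lia), ← Category.assoc, unitToSheafHom_comp_sheafHomMap]
  rfl

/-- The `E`-direction on a section term: `(section γ_{-i}) ≫ ι ≫ D₂ = (-1)^{n+1} • section (d_E ≫ γ_{-i}) ≫ ι`.
[cite: Weibel1994, 2.7.4–2.7.5 (Hom cochain complex)] -/
lemma secTerm_D₂ (n i : ℤ) (ψ : E.X (-i) ⟶ I.X (n - i)) :
    secTerm X E I n i (n - i) (by lia) ψ ≫
        HomologicalComplex.mapBifunctor.D₂ I (dualComplex X E) (sheafHomBifunctor X).flip (ComplexShape.up ℤ) n (n + 1) =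
      ((n + 1).negOnePow : ℤˣ) • secTerm X E I (n + 1) (i + 1) (n - i) (by lia) (E.d (-(i + 1)) (-i) ≫ ψ) := by
  rw [secTerm, Category.assoc, ι_D₂ X E I (n - i) i n (n + 1) (by lia) (by lia), Linear.comp_units_smul, ← Category.assoc,
    unitToSheafHom_comp_sheafHomMapLeft]
  rfl

variable [E.IsStrictlyGE a] [E.IsStrictlyLE b]

omit [E.IsStrictlyGE a] [E.IsStrictlyLE b] in
/-- The right-hand side `cochainSection γ ≫ d`, summand by summand (`ι_D₁`, `ι_D₂`). [cite: Weibel1994, 2.7.4–2.7.5 (Hom cochain complex)] -/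
private lemma cochainSection_comp_d (n : ℤ) (γ : Cochain E I n) :
    cochainSection X E I a b n γ ≫ (homComplex X E I).d n (n + 1) =
      ∑ i ∈ Finset.Icc (-b) (-a),
          secTerm X E I (n + 1) i (n - i + 1) (by lia) (γ.v (-i) (n - i) (by lia) ≫ I.d (n - i) (n - i + 1)) +
        ((n + 1).negOnePow : ℤˣ) • ∑ i ∈ Finset.Icc (-b) (-a),
          secTerm X E I (n + 1) (i + 1) (n - i) (by lia) (E.d (-(i + 1)) (-i) ≫ γ.v (-i) (n - i) (by lia)) := by
  rw [cochainSection, Preadditive.sum_comp, Finset.smul_sum, ← Finset.sum_add_distrib]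
  exact Finset.sum_congr rfl fun i _ => by
    rw [HomologicalComplex.mapBifunctor.d_eq, Preadditive.comp_add, secTerm_D₁, secTerm_D₂]

omit [E.IsStrictlyGE a] [E.IsStrictlyLE b] in
/-- The left-hand side `cochainSection (δ γ)`, summand by summand (`Cochain.δ_v` with `q₁ = n - i`, `q₂ = -i + 1`).
[cite: Weibel1994, 2.7.4–2.7.5 (Hom cochain complex)] -/
private lemma cochainSection_δ_expand (n : ℤ) (γ : Cochain E I n) :
    cochainSection X E I a b (n + 1) (δ n (n + 1) γ) =
      ∑ i ∈ Finset.Icc (-b) (-a),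
          secTerm X E I (n + 1) i (n - i + 1) (by lia) (γ.v (-i) (n - i) (by lia) ≫ I.d (n - i) (n - i + 1)) +
        ((n + 1).negOnePow : ℤˣ) • ∑ i ∈ Finset.Icc (-b) (-a),
          secTerm X E I (n + 1) i (n + 1 - i) (by lia) (E.d (-i) (-i + 1) ≫ γ.v (-i + 1) (n + 1 - i) (by lia)) := by
  rw [cochainSection, Finset.smul_sum, ← Finset.sum_add_distrib]
  exact Finset.sum_congr rfl fun i _ => by
    rw [δ_v n (n + 1) rfl γ (-i) (n + 1 - i) (by lia) (n - i) (-i + 1) (by lia) (by lia), secTerm_add, secTerm_units_smul,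
      secTerm_comp_d_congr X E I (n + 1) i (n - i) (n + 1 - i) (n - i + 1) (by lia) (by lia) (by lia)]

/-- Re-indexing a sum over an integer window by one, the new bottom term vanishing. [folklore: elementary] -/
private lemma sum_Icc_shift {M : Type*} [AddCommMonoid M] (T : ℤ → M) (lo hi : ℤ) (h0 : T lo = 0) :
    ∑ i ∈ Finset.Icc lo hi, T (i + 1) = ∑ i ∈ Finset.Icc lo (hi + 1), T i :=
  calc ∑ i ∈ Finset.Icc lo hi, T (i + 1) = ∑ i ∈ (Finset.Icc lo hi).map (addRightEmbedding 1), T i := by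
        rw [Finset.sum_map]; rfl
    _ = ∑ i ∈ Finset.Icc (lo + 1) (hi + 1), T i := by rw [Finset.map_add_right_Icc]
    _ = ∑ i ∈ Finset.Icc lo (hi + 1), T i :=
      Finset.sum_subset (Finset.Icc_subset_Icc (by lia) le_rfl) fun j hj hj' => by
        obtain rfl : j = lo := by
          simp only [Finset.mem_Icc, not_and, not_le] at hj hj'
          lia
        exact h0

/-- Transport of the shifted `E`-term to the window form. [cite: Weibel1994, 2.7.4–2.7.5 (Hom cochain complex)] -/
private lemma secTerm_shift (n i : ℤ) (γ : Cochain E I n) :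
    secTerm X E I (n + 1) (i + 1) (n - i) (by lia) (E.d (-(i + 1)) (-i) ≫ γ.v (-i) (n - i) (by lia)) =
      secTerm X E I (n + 1) (i + 1) (n + 1 - (i + 1)) (by lia)
        (E.d (-(i + 1)) (-(i + 1) + 1) ≫ γ.v (-(i + 1) + 1) (n + 1 - (i + 1)) (by lia)) :=
  secTerm_d_comp_v_congr X E I γ (n + 1) (i + 1) (by lia) (by lia) _ _ _ _

/-- The `E`-terms of both sides agree: both are `∑_{j ∈ [-b, -a+1]} section (d_E ≫ γ_{-j+1}) ≫ ι`, the two boundary terms vanishing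
because `E• ∈ [a, b]` (as in `HomComplexUnit.unitDeg₀_d`). [cite: Weibel1994, 2.7.4–2.7.5 (Hom cochain complex)] -/
private lemma sum_secTerm_shift (n : ℤ) (γ : Cochain E I n) :
    ∑ i ∈ Finset.Icc (-b) (-a),
        secTerm X E I (n + 1) (i + 1) (n - i) (by lia) (E.d (-(i + 1)) (-i) ≫ γ.v (-i) (n - i) (by lia)) =
      ∑ i ∈ Finset.Icc (-b) (-a),
        secTerm X E I (n + 1) i (n + 1 - i) (by lia) (E.d (-i) (-i + 1) ≫ γ.v (-i + 1) (n + 1 - i) (by lia)) := by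
  have hT := sum_Icc_shift
    (fun j => secTerm X E I (n + 1) j (n + 1 - j) (by lia) (E.d (-j) (-j + 1) ≫ γ.v (-j + 1) (n + 1 - j) (by lia))) (-b) (-a) (by
      rw [(E.isZero_of_isStrictlyLE b (-(-b) + 1) (by lia)).eq_of_tgt (E.d (-(-b)) (-(-b) + 1)) 0, zero_comp, secTerm_zero])
  rw [Finset.sum_congr rfl fun i _ => secTerm_shift X E I n i γ, hT]
  symm
  exact Finset.sum_subset (Finset.Icc_subset_Icc le_rfl (by lia)) fun j hj hj' => by
    obtain rfl : j = -a + 1 := by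
      simp only [Finset.mem_Icc, not_and, not_le] at hj hj'
      lia
    rw [(E.isZero_of_isStrictlyGE a (-(-a + 1)) (by lia)).eq_of_src (E.d (-(-a + 1)) (-(-a + 1) + 1)) 0, zero_comp, secTerm_zero]

/-- **THE SECTION OF A COCHAIN COMMUTES WITH THE DIFFERENTIALS**: `cochainSection (δ γ) = cochainSection γ ≫ d_{𝓗om•(E•, I•)}` —
Mathlib's Hom-complex sign (`δ γ = γ ≫ d_I + (-1)^{n+1} d_E ≫ γ`, `Cochain.δ_v`) is the tree's (`ι_D₁`, `ι_D₂`); the `d_E`-terms match after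
re-indexing the window by one, the two boundary terms vanishing because `E• ∈ [a, b]` (as in `HomComplexUnit.unitDeg₀_d`).
[cite: Weibel1994, 2.7.4–2.7.5 (Hom cochain complex)] [cite: StacksProject, More on Algebra, Section «Hom complexes»] -/
theorem cochainSection_δ (n : ℤ) (γ : Cochain E I n) :
    cochainSection X E I a b (n + 1) (δ n (n + 1) γ) = cochainSection X E I a b n γ ≫ (homComplex X E I).d n (n + 1) := by
  rw [cochainSection_comp_d, cochainSection_δ_expand, sum_secTerm_shift]

/-! ## §3 The morphism of cochain complexes `HomComplex E I ⟶ HomComplex 𝒪_X[0] 𝓗om•(E•, I•)` -/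

/-- The degree-`n` map `Cochain E I n →+ Cochain 𝒪_X[0] 𝓗om•(E•, I•) n`, `γ ↦ fromSingleMk (cochainSection γ)`.
[cite: Weibel1994, 2.7.4–2.7.5 (Hom cochain complex)] -/
def cochainsHomDeg (n : ℤ) :
    Cochain E I n →+ Cochain ((CochainComplex.singleFunctor X.Modules 0).obj (unitModule X)) (homComplex X E I) n where
  toFun γ := Cochain.fromSingleMk (cochainSection X E I a b n γ) (zero_add n)
  map_zero' := by rw [cochainSection_zero, Cochain.fromSingleMk_zero]
  map_add' γ γ' := by rw [cochainSection_add, Cochain.fromSingleMk_add]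

/-- **`HomComplex E I ⟶ HomComplex 𝒪_X[0] 𝓗om•(E•, I•)`** as a morphism of cochain complexes of abelian groups (`γ ↦ (a ↦ a·γ)`): a chain
map by `cochainSection_δ` and `Cochain.δ_fromSingleMk`. [cite: Weibel1994, 2.7.4–2.7.5 (Hom cochain complex)]
[cite: StacksProject, More on Algebra, Section «Hom complexes»] -/
def cochainsHom :
    CochainComplex.HomComplex E I ⟶
      CochainComplex.HomComplex ((CochainComplex.singleFunctor X.Modules 0).obj (unitModule X)) (homComplex X E I) where
  f n := AddCommGrpCat.ofHom (cochainsHomDeg X E I a b n)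
  comm' n m hnm := by
    obtain rfl : n + 1 = m := hnm
    ext γ
    change δ n (n + 1) (Cochain.fromSingleMk (cochainSection X E I a b n γ) (zero_add n)) =
      Cochain.fromSingleMk (cochainSection X E I a b (n + 1) (δ n (n + 1) γ)) (zero_add (n + 1))
    rw [Cochain.δ_fromSingleMk _ _ (n + 1) (n + 1) (zero_add (n + 1)), cochainSection_δ]

/-- Components of `cochainsHom` (definitional). [cite: Weibel1994, 2.7.4–2.7.5 (Hom cochain complex)] -/
lemma cochainsHom_f_apply (n : ℤ) (γ : Cochain E I n) :
    (cochainsHom X E I a b).f n γ = Cochain.fromSingleMk (cochainSection X E I a b n γ) (zero_add n) := rfl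

/-! ## §4 Injectivity -/

omit [E.IsStrictlyGE a] [E.IsStrictlyLE b] in
/-- Projecting the section of a cochain to the window coordinate `t`: `cochainSection γ ≫ toPi ≫ π_t = section of γ_{-t}`.
[cite: Weibel1994, 2.7.4–2.7.5 (Hom cochain complex)] -/
lemma cochainSection_toPi_π (n : ℤ) (γ : Cochain E I n) (t : Finset.Icc (-b) (-a)) :
    cochainSection X E I a b n γ ≫ toPi X E I a b n ≫ Pi.π (summand X E I a b n) t = unitToSheafHom (γ.v (-(t : ℤ)) (n - t) (by lia)) := by
  rw [cochainSection, Preadditive.sum_comp, Finset.sum_eq_single (t : ℤ)]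
  · rw [secTerm, Category.assoc, ι_toPi_π, component_self, Category.comp_id]
  · intro i _ hit
    rw [secTerm, Category.assoc, ι_toPi_π, component_of_ne X E I a b n _ _ _ t hit, comp_zero]
  · intro ht
    exact absurd t.2 ht

omit [E.IsStrictlyGE a] [E.IsStrictlyLE b] in
/-- A component of a cochain vanishes if it does after transport of its indices. [folklore] -/
private lemma v_eq_zero_of_eq {n : ℤ} (γ : Cochain E I n) {p p' q q' : ℤ} (hp : p = p') (hq : q = q') (h' : p' + n = q')
    (h : γ.v p' q' h' = 0) (hpq : p + n = q) : γ.v p q hpq = 0 := by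
  subst hp hq; exact h

/-- **`cochainSection` is injective**: a cochain all of whose window components have zero section is zero (components outside the
window start at a zero object). [cite: Weibel1994, 2.7.4–2.7.5 (Hom cochain complex)] -/
theorem cochainSection_injective (n : ℤ) : Function.Injective (cochainSection X E I a b n) := by
  have key : ∀ γ : Cochain E I n, cochainSection X E I a b n γ = 0 → γ = 0 := fun γ h => by
    refine Cochain.ext γ 0 fun p q hpq => ?_
    rw [Cochain.zero_v]
    by_cases hp : -p ∈ Finset.Icc (-b) (-a)
    · have ht := cochainSection_toPi_π X E I a b n γ ⟨-p, hp⟩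
      rw [h, zero_comp] at ht
      exact v_eq_zero_of_eq X E I γ (neg_neg p).symm (by lia) (by lia) ((unitToSheafHom_eq_zero_iff _).1 ht.symm) hpq
    · have hp' : p < a ∨ b < p := by
        simp only [Finset.mem_Icc, not_and_or, not_le] at hp
        lia
      rcases hp' with hp' | hp'
      · exact (E.isZero_of_isStrictlyGE a p hp').eq_of_src _ _
      · exact (E.isZero_of_isStrictlyLE b p hp').eq_of_src _ _
  intro γ γ' h
  rw [← sub_eq_zero]
  refine key _ ?_
  rw [sub_eq_add_neg, cochainSection_add, h, ← cochainSection_add, add_neg_cancel, cochainSection_zero]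

/-! ## §5 Surjectivity and the isomorphism of Hom complexes -/

omit [E.IsStrictlyGE a] [E.IsStrictlyLE b] in
/-- Transport of a family `ψ_i : E^{-i} → I^{n-i}` to the components `E^p → I^q` (`p + n = q`) of a cochain.
[cite: Weibel1994, 2.7.4–2.7.5 (Hom cochain complex)] -/
private def liftV (n : ℤ) (ψ : ∀ i : ℤ, E.X (-i) ⟶ I.X (n - i)) (p q : ℤ) (hpq : p + n = q) : E.X p ⟶ I.X q :=
  (E.XIsoOfEq (neg_neg p)).inv ≫ ψ (-p) ≫ (I.XIsoOfEq (show n - -p = q by lia)).hom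

omit [E.IsStrictlyGE a] [E.IsStrictlyLE b] in
/-- The transport is neutral on the window coordinates. [cite: Weibel1994, 2.7.4–2.7.5 (Hom cochain complex)] -/
private lemma liftV_v (n i : ℤ) (ψ : ∀ i : ℤ, E.X (-i) ⟶ I.X (n - i)) : liftV X E I n ψ (-i) (n - i) (by lia) = ψ i := by
  have key : ∀ (j : ℤ) (e : j = i) (h₁ : -j = -i) (h₂ : n - j = n - i),
      (E.XIsoOfEq h₁).inv ≫ ψ j ≫ (I.XIsoOfEq h₂).hom = ψ i := fun j e h₁ h₂ => by
    subst e
    simp only [HomologicalComplex.XIsoOfEq_rfl, Iso.refl_inv, Iso.refl_hom, Category.id_comp, Category.comp_id]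
  exact key (-(-i)) (neg_neg i) _ _

/-- **`cochainSection` is surjective** (`𝓗om•(E•, I•)^n ≅ ∏_{window} 𝓗om(E^{-i}, I^{n-i})`, `XIsoPi`, and every coordinate
`𝒪_X ⟶ 𝓗om(E^{-i}, I^{n-i})` is the section of a morphism, `bijective_unitToSheafHom`). [cite: Weibel1994, 2.7.4–2.7.5 (Hom cochain complex)]
[cite: Hartshorne1977, II §5 (sheaf Hom, p. 109)] -/
theorem cochainSection_surjective (n : ℤ) : Function.Surjective (cochainSection X E I a b n) := fun φ => by
  classical
  choose ψ hψ using fun t : Finset.Icc (-b) (-a) =>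
    (bijective_unitToSheafHom (E.X (-(t : ℤ))) (I.X (n - t))).2 (φ ≫ toPi X E I a b n ≫ Pi.π (summand X E I a b n) t)
  refine ⟨Cochain.mk (liftV X E I n fun i => if h : i ∈ Finset.Icc (-b) (-a) then ψ ⟨i, h⟩ else 0), ?_⟩
  rw [← cancel_mono (XIsoPi X E I a b n).hom]
  refine Pi.hom_ext _ _ fun t => ?_
  rw [Category.assoc, Category.assoc]
  change cochainSection X E I a b n _ ≫ toPi X E I a b n ≫ Pi.π (summand X E I a b n) t =
    φ ≫ toPi X E I a b n ≫ Pi.π (summand X E I a b n) t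
  rw [cochainSection_toPi_π, Cochain.mk_v, liftV_v, dif_pos t.2]
  exact hψ t

/-- **`cochainSection : Cochain E I n ≃ Hom(𝒪_X, 𝓗om•(E•, I•)^n)` is a bijection.** [cite: Weibel1994, 2.7.4–2.7.5 (Hom cochain complex)] -/
theorem cochainSection_bijective (n : ℤ) : Function.Bijective (cochainSection X E I a b n) :=
  ⟨cochainSection_injective X E I a b n, cochainSection_surjective X E I a b n⟩

/-- Hence every component of `cochainsHom` is a bijection (`Cochain.fromSingleEquiv`). [cite: Weibel1994, 2.7.4–2.7.5 (Hom cochain complex)] -/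
theorem cochainsHomDeg_bijective (n : ℤ) : Function.Bijective (cochainsHomDeg X E I a b n) :=
  (Cochain.fromSingleEquiv (p := 0) (q := n) (n := n)
      (X := unitModule X) (K := homComplex X E I) (zero_add n)).symm.bijective.comp (cochainSection_bijective X E I a b n)

/-- `cochainsHom` is an isomorphism of cochain complexes of abelian groups. [cite: Weibel1994, 2.7.4–2.7.5 (Hom cochain complex)] -/
theorem isIso_cochainsHom : IsIso (cochainsHom X E I a b) := by
  haveI : ∀ n, IsIso ((cochainsHom X E I a b).f n) := fun n => by
    have h := (AddEquiv.toAddCommGrpIso (X := AddCommGrpCat.of (Cochain E I n))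
      (Y := AddCommGrpCat.of (Cochain ((CochainComplex.singleFunctor X.Modules 0).obj (unitModule X)) (homComplex X E I) n))
      (AddEquiv.ofBijective (cochainsHomDeg X E I a b n) (cochainsHomDeg_bijective X E I a b n))).isIso_hom
    exact h
  exact HomologicalComplex.Hom.isIso_of_components _

/-- **`HomComplex E I ≅ HomComplex 𝒪_X[0] 𝓗om•(E•, I•)`** (`γ ↦ (a ↦ a·γ)`) as cochain complexes of abelian groups, for
`E• ∈ [a, b]`: the complex of (graded) morphisms `E• → I•` IS the complex of global sections of the internal Hom complex.
[cite: Weibel1994, 2.7.4–2.7.5 (Hom cochain complex)] [cite: StacksProject, More on Algebra, Section «Hom complexes»] -/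
def cochainsIso :
    CochainComplex.HomComplex E I ≅
      CochainComplex.HomComplex ((CochainComplex.singleFunctor X.Modules 0).obj (unitModule X)) (homComplex X E I) :=
  haveI := isIso_cochainsHom X E I a b
  asIso (cochainsHom X E I a b)

/-- `cochainsIso.hom = cochainsHom` (definitional). [cite: Weibel1994, 2.7.4–2.7.5 (Hom cochain complex)] -/
lemma cochainsIso_hom : (cochainsIso X E I a b).hom = cochainsHom X E I a b := rfl

end HomComplex

end Literature.AlgebraicGeometry.HodgeTheory

end
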